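import Summits.Schanuel.Schanuel.Theorems.RootDecomp1JFlagCells

/-!
# RootDecomp1J — decided cells of P5 = `SecondExpOverInhomBakerFields` (lens-3 g21, node v11 §11)

Port (`--supports stmt-Schanuel-27658`) of §11 of the lens-3 node file
`HOME/decomp-schanuel-lens-3/v11/PeriodFlagSplit.lean`: the KERNEL-CERTIFIED CELLS of the crux
P5 = `Rel(𝓔|𝓛⋆)` = `SecondExpOverInhomBakerFields` (stmt-Schanuel-27658 of route-Schanuel-RootDecomp1J;
leaf tag ATTACKABLE, whose docstring cites these declarations by name):

* `secondExpOverInhomBaker_cell_LW` — the LINDEMANN–WEIERSTRASS FAMILY over ALGEBRAIC bases, all ranks: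
  for algebraic `β' : Fin k`, `β : Fin m` with `(β' | β)` `ℚ`-free, the item's conclusion at
  `(y; z) = (β'; e^{β})` — `trdeg_{ℚ(β', e^{β'})} (e^β, e^{e^β}) ≥ m` (e.g. `e ∉ acl ℚ(e^{√2})`), proved
  outright; a relative count over transcendental base fields `ℚ(β', e^{β'})` of every transcendence
  degree `k`;
* `secondExpOverInhomBaker_cell_pi` — the NESTERENKO CELL `(y; z) = ((iπ); (e^π))`:
  `trdeg_{ℚ(iπ)} ℚ(iπ)(e^π, e^{e^π}) ≥ 1`, i.e. `e^π ∉ acl ℚ(π)`, modulo the tree's named fact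
  `Literature.NumberTheory.Transcendental.nesterenko` (PROVED in the tree, `nesterenko_holds`; hypothesis
  `hN` only because that module tower has no hub olean);
* membership certificates `exp_mem_secondExp` (`e^w ∈ 𝓔` for `w ∈ 𝓛⋆`), `exp_pi_mem_secondExp`,
  `exp_one_mem_secondExp` (the flagship `((1); (e))` — `e^e ∉ acl ℚ(e)`, Schneider's 8th problem, OPEN —
  is a P5 instance), `exp_algebraic_mem_secondExp`.

`𝓛⋆ = span_ℚ(ℚ̄ ∪ {β·l})` and `𝓔 = span_ℚ(𝓛⋆-generators ∪ exp(𝓛⋆))` are written out verbatim as in the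
route file (this file defines nothing). Tools: `RootDecomp1DFlagSplit.{trdeg_adjoin_le_cardinalMk,
trdeg_gens_lt_aleph0, rel_iff_add, range_comp_append}`, `RootDecomp1JFlagCells.{pi_mem_bakerPeriods, algebraic_mem_inhomBaker}` (+ private copies of `isAlgebraic_I`, `algebraicIndependent_pi_exp_pi`, whose tree twins the gate's dedup names),
`Literature.Barriers.Schanuel.trdeg_adjoin_union_eq_of_isAlgebraic`. 0 sorry.
[cite: Waldschmidt2000, §1.4] [cite: NesterenkoPhilippon2001, Ch. 3 Cor. 1.2] [cite: Chudnovsky1984, p. 22]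
-/

noncomputable section

open Complex IntermediateField

namespace Summit.Schanuel.Schanuel.Theorems.RootDecomp1JSecondExpCells

open Summit.Schanuel.Schanuel.Theorems.RootDecomp1DFlagSplit (trdeg_adjoin_le_cardinalMk
  trdeg_gens_lt_aleph0 rel_iff_add range_comp_append)
open Summit.Schanuel.Schanuel.Theorems.RootDecomp1JFlagCells (pi_mem_bakerPeriods algebraic_mem_inhomBaker)
open Literature.NumberTheory.Transcendental (nesterenko algebraicIndependent_exp_holds)

/-- `I` is algebraic (`I² + 1 = 0`); private copy (tree twin `RigidCore.CalibrationB.isAlgebraic_I`). [folklore] -/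
private theorem isAlgebraic_I : IsAlgebraic ℚ I := by
  refine ⟨Polynomial.X ^ 2 + Polynomial.C 1, ?_, ?_⟩
  · exact (Polynomial.monic_X_pow_add_C (1 : ℚ) (by norm_num)).ne_zero
  · simp [Complex.I_sq]

/-- `π, e^π` are algebraically independent over `ℚ` (as complex numbers), from the named fact
`Literature.NumberTheory.Transcendental.nesterenko` (PROVED in the tree, `nesterenko_holds`); private copy of
`RootDecomp1EEngineType.algebraicIndependent_pi_exp_pi` to keep this file inside the 1D/1J import cone.
[cite: NesterenkoPhilippon2001, Ch. 3 Cor. 1.2] -/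
private theorem algebraicIndependent_pi_exp_pi (hN : nesterenko) :
    AlgebraicIndependent ℚ ![(Real.pi : ℂ), cexp (Real.pi : ℂ)] := by
  have hC : AlgebraicIndependent ℚ
      ((algebraMap ℝ ℂ).toRatAlgHom ∘ ![Real.pi, Real.exp Real.pi, Real.Gamma (1 / 4)]) :=
    hN.map' (f := (algebraMap ℝ ℂ).toRatAlgHom) (by
      intro a b h
      simpa [RingHom.toRatAlgHom_apply] using h)
  have h := hC.comp ![0, 1] (by decide)
  convert h using 1
  funext i
  fin_cases i <;> simp [RingHom.toRatAlgHom_apply, Complex.ofReal_exp]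

/-! ### §1 Membership certificates: second exponentials -/

/-- `e^w ∈ 𝓔` for every inhomogeneous Baker period `w ∈ 𝓛⋆`. -/
theorem exp_mem_secondExp {a : ℂ}
    (ha : a ∈ Submodule.span ℚ ({z : ℂ | IsAlgebraic ℚ z} ∪
      {z : ℂ | ∃ β l : ℂ, IsAlgebraic ℚ β ∧ IsAlgebraic ℚ (Complex.exp l) ∧ z = β * l})) :
    cexp a ∈ Submodule.span ℚ (({z : ℂ | IsAlgebraic ℚ z} ∪
        {z : ℂ | ∃ β l : ℂ, IsAlgebraic ℚ β ∧ IsAlgebraic ℚ (Complex.exp l) ∧ z = β * l}) ∪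
      Complex.exp '' ↑(Submodule.span ℚ ({z : ℂ | IsAlgebraic ℚ z} ∪
        {z : ℂ | ∃ β l : ℂ, IsAlgebraic ℚ β ∧ IsAlgebraic ℚ (Complex.exp l) ∧ z = β * l}))) :=
  Submodule.subset_span (Or.inr ⟨a, ha, rfl⟩)

/-- `e^π ∈ 𝓔` (second exponential of the Baker period `π`): `((iπ); (e^π))` has its `z` in `𝓔`. -/
theorem exp_pi_mem_secondExp :
    cexp (Real.pi : ℂ) ∈ Submodule.span ℚ (({z : ℂ | IsAlgebraic ℚ z} ∪
        {z : ℂ | ∃ β l : ℂ, IsAlgebraic ℚ β ∧ IsAlgebraic ℚ (Complex.exp l) ∧ z = β * l}) ∪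
      Complex.exp '' ↑(Submodule.span ℚ ({z : ℂ | IsAlgebraic ℚ z} ∪
        {z : ℂ | ∃ β l : ℂ, IsAlgebraic ℚ β ∧ IsAlgebraic ℚ (Complex.exp l) ∧ z = β * l}))) :=
  exp_mem_secondExp (Submodule.span_mono Set.subset_union_right pi_mem_bakerPeriods)

/-- `e^a ∈ 𝓔` for `a` algebraic; in particular `e = e^1 ∈ 𝓔`, so the flagship `((1); (e))` —
`e^e ∉ acl ℚ(e)`, OPEN — is a P5 instance. -/
theorem exp_algebraic_mem_secondExp {a : ℂ} (ha : IsAlgebraic ℚ a) :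
    cexp a ∈ Submodule.span ℚ (({z : ℂ | IsAlgebraic ℚ z} ∪
        {z : ℂ | ∃ β l : ℂ, IsAlgebraic ℚ β ∧ IsAlgebraic ℚ (Complex.exp l) ∧ z = β * l}) ∪
      Complex.exp '' ↑(Submodule.span ℚ ({z : ℂ | IsAlgebraic ℚ z} ∪
        {z : ℂ | ∃ β l : ℂ, IsAlgebraic ℚ β ∧ IsAlgebraic ℚ (Complex.exp l) ∧ z = β * l}))) :=
  exp_mem_secondExp (algebraic_mem_inhomBaker ha)

/-- `e = e^1 ∈ 𝓔`: the flagship `((1); (e))` of P5 (`e^e ∉ acl ℚ(e)`, OPEN) is an instance. -/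
theorem exp_one_mem_secondExp :
    cexp 1 ∈ Submodule.span ℚ (({z : ℂ | IsAlgebraic ℚ z} ∪
        {z : ℂ | ∃ β l : ℂ, IsAlgebraic ℚ β ∧ IsAlgebraic ℚ (Complex.exp l) ∧ z = β * l}) ∪
      Complex.exp '' ↑(Submodule.span ℚ ({z : ℂ | IsAlgebraic ℚ z} ∪
        {z : ℂ | ∃ β l : ℂ, IsAlgebraic ℚ β ∧ IsAlgebraic ℚ (Complex.exp l) ∧ z = β * l}))) :=
  exp_algebraic_mem_secondExp isAlgebraic_one

/-! ### §2 The Lindemann–Weierstrass family over algebraic bases (all ranks) -/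

/-- CELL FAMILY (P5 = `SecondExpOverInhomBakerFields`, stmt-Schanuel-27658, over an ALGEBRAIC base, all
ranks; = Lindemann–Weierstrass `algebraicIndependent_exp_holds`): for algebraic tuples `β' : Fin k`,
`β : Fin m` with `(β' | β)` `ℚ`-free, the item's conclusion at `(y; z) = (β'; e^{β})` —
`trdeg_{ℚ(β', e^{β'})} (e^β, e^{e^β}) ≥ m` — proved outright. Examples: `e ∉ acl ℚ(e^{√2})` (`β' = (√2)`,
`β = (1)`), `trdeg_{ℚ(e)} (e^{√2}, e^{√3}, e^{e^√2}, e^{e^√3}) ≥ 2`. (`y ⊂ 𝓛⋆` by `algebraic_mem_inhomBaker`,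
`z ⊂ 𝓔` by `exp_algebraic_mem_secondExp`.) [cite: Waldschmidt2000, §1.4] -/
theorem secondExpOverInhomBaker_cell_LW {k m : ℕ} (β' : Fin k → ℂ) (β : Fin m → ℂ)
    (hβ' : ∀ i, IsAlgebraic ℚ (β' i)) (hβ : ∀ j, IsAlgebraic ℚ (β j))
    (hli : LinearIndependent ℚ (fun t : Fin (k + m) => Sum.elim β' β (finSumFinEquiv.symm t))) :
    (m : Cardinal) ≤ Algebra.trdeg ↥(adjoin ℚ (Set.range β' ∪ Set.range (cexp ∘ β')))
      ↥(adjoin ↥(adjoin ℚ (Set.range β' ∪ Set.range (cexp ∘ β')))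
        (Set.range (cexp ∘ β) ∪ Set.range (cexp ∘ (cexp ∘ β)))) := by
  have hfin := trdeg_gens_lt_aleph0 β'
  refine (rel_iff_add _ _ hfin m).2 ?_
  -- the base has transcendence degree ≤ k
  have hbase : Algebra.trdeg ℚ ↥(adjoin ℚ (Set.range β' ∪ Set.range (cexp ∘ β'))) ≤ k := by
    have halg : ∀ a ∈ Set.range β', IsAlgebraic ℚ a := by
      rintro _ ⟨i, rfl⟩
      exact hβ' i
    calc Algebra.trdeg ℚ ↥(adjoin ℚ (Set.range β' ∪ Set.range (cexp ∘ β')))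
        = Algebra.trdeg ℚ ↥(adjoin ℚ (Set.range (cexp ∘ β') ∪ Set.range β')) := by
          rw [Set.union_comm]
      _ = Algebra.trdeg ℚ ↥(adjoin ℚ (Set.range (cexp ∘ β'))) :=
          Literature.Barriers.Schanuel.trdeg_adjoin_union_eq_of_isAlgebraic _ _ halg
      _ ≤ Cardinal.mk (Set.range (cexp ∘ β')) := trdeg_adjoin_le_cardinalMk _
      _ ≤ k := by simpa using Cardinal.mk_range_le (f := cexp ∘ β')
  -- the top field contains `e^{β'}, e^{β}`, algebraically independent by Lindemann–Weierstrass
  let x : Fin (k + m) → ℂ := fun t => Sum.elim β' β (finSumFinEquiv.symm t)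
  have hx_alg : ∀ t, IsAlgebraic ℚ (x t) := by
    intro t
    change IsAlgebraic ℚ (Sum.elim β' β (finSumFinEquiv.symm t))
    rcases finSumFinEquiv.symm t with i | j
    · exact hβ' i
    · exact hβ j
  have hLW : AlgebraicIndependent ℚ fun t => cexp (x t) := algebraicIndependent_exp_holds x hx_alg hli
  set F := adjoin ℚ ((Set.range β' ∪ Set.range (cexp ∘ β')) ∪
    (Set.range (cexp ∘ β) ∪ Set.range (cexp ∘ (cexp ∘ β)))) with hF
  have hrange : Set.range (cexp ∘ x) = Set.range (cexp ∘ β') ∪ Set.range (cexp ∘ β) :=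
    range_comp_append cexp β' β
  have hxF : ∀ t, cexp (x t) ∈ F := by
    intro t
    have ht : cexp (x t) ∈ Set.range (cexp ∘ x) := ⟨t, rfl⟩
    rw [hrange] at ht
    rcases ht with h | h
    · exact subset_adjoin ℚ _ (Or.inl (Or.inr h))
    · exact subset_adjoin ℚ _ (Or.inr (Or.inl h))
  let x' : Fin (k + m) → F := fun t => ⟨cexp (x t), hxF t⟩
  have hx' : AlgebraicIndependent ℚ x' := AlgebraicIndependent.of_comp F.val hLW
  have hF2 : ((k + m : ℕ) : Cardinal) ≤ Algebra.trdeg ℚ F := by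
    simpa using hx'.cardinalMk_le_trdeg
  calc Algebra.trdeg ℚ ↥(adjoin ℚ (Set.range β' ∪ Set.range (cexp ∘ β'))) + (m : Cardinal)
      ≤ (k : Cardinal) + (m : Cardinal) := add_le_add hbase le_rfl
    _ = ((k + m : ℕ) : Cardinal) := (Nat.cast_add k m).symm
    _ ≤ Algebra.trdeg ℚ F := hF2

/-! ### §3 The Nesterenko cell over the transcendental base `ℚ(iπ)` -/

/-- CELL (P5 = `SecondExpOverInhomBakerFields`, stmt-Schanuel-27658, over a TRANSCENDENTAL base;
Nesterenko 1996): the instance `(y; z) = ((iπ); (e^π))` — `trdeg_{ℚ(iπ)} ℚ(iπ)(e^π, e^{e^π}) ≥ 1`, i.e.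
`e^π ∉ acl ℚ(π)`, modulo the named fact `nesterenko` (discharged in the tree: `nesterenko_holds`). The top
field `ℚ(iπ, e^π, e^{e^π})` need not contain `π`; adjoining the algebraic number `i` does not change its
transcendence degree and exhibits `π = (iπ)(−i)`. (`y ⊂ 𝓛⋆`: `RootDecomp1JFlagCells.pi_mul_I_mem_bakerPeriods`;
`z ⊂ 𝓔`: `exp_pi_mem_secondExp`.) [cite: NesterenkoPhilippon2001, Ch. 3 Cor. 1.2] -/
theorem secondExpOverInhomBaker_cell_pi (hN : nesterenko) :
    ((1 : ℕ) : Cardinal) ≤ Algebra.trdeg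
      ↥(adjoin ℚ (Set.range ![(Real.pi : ℂ) * I] ∪ Set.range (cexp ∘ ![(Real.pi : ℂ) * I])))
      ↥(adjoin ↥(adjoin ℚ (Set.range ![(Real.pi : ℂ) * I] ∪ Set.range (cexp ∘ ![(Real.pi : ℂ) * I])))
        (Set.range ![cexp (Real.pi : ℂ)] ∪ Set.range (cexp ∘ ![cexp (Real.pi : ℂ)]))) := by
  have hfin := trdeg_gens_lt_aleph0 ![(Real.pi : ℂ) * I]
  refine (rel_iff_add _ _ hfin 1).2 ?_
  -- the base has transcendence degree ≤ 1 (`e^{iπ} = -1` is algebraic)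
  have hbase : Algebra.trdeg ℚ
      ↥(adjoin ℚ (Set.range ![(Real.pi : ℂ) * I] ∪ Set.range (cexp ∘ ![(Real.pi : ℂ) * I]))) ≤ 1 := by
    have halg : ∀ a ∈ Set.range (cexp ∘ ![(Real.pi : ℂ) * I]), IsAlgebraic ℚ a := by
      rintro _ ⟨i, rfl⟩
      have hi : i = 0 := Subsingleton.elim _ _
      subst hi
      change IsAlgebraic ℚ (cexp ((Real.pi : ℂ) * I))
      rw [Complex.exp_pi_mul_I]
      exact isAlgebraic_one.neg
    calc Algebra.trdeg ℚ
          ↥(adjoin ℚ (Set.range ![(Real.pi : ℂ) * I] ∪ Set.range (cexp ∘ ![(Real.pi : ℂ) * I])))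
        = Algebra.trdeg ℚ ↥(adjoin ℚ (Set.range ![(Real.pi : ℂ) * I])) :=
          Literature.Barriers.Schanuel.trdeg_adjoin_union_eq_of_isAlgebraic _ _ halg
      _ ≤ Cardinal.mk (Set.range ![(Real.pi : ℂ) * I]) := trdeg_adjoin_le_cardinalMk _
      _ ≤ 1 := by simp
  -- the top field, with `i` adjoined, contains `π, e^π`, algebraically independent by Nesterenko
  set G := (Set.range ![(Real.pi : ℂ) * I] ∪ Set.range (cexp ∘ ![(Real.pi : ℂ) * I])) ∪
    (Set.range ![cexp (Real.pi : ℂ)] ∪ Set.range (cexp ∘ ![cexp (Real.pi : ℂ)])) with hG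
  have hFI : Algebra.trdeg ℚ ↥(adjoin ℚ (G ∪ {I})) = Algebra.trdeg ℚ ↥(adjoin ℚ G) :=
    Literature.Barriers.Schanuel.trdeg_adjoin_union_eq_of_isAlgebraic G {I} (fun a ha => by
      rw [Set.mem_singleton_iff] at ha
      rw [ha]
      exact isAlgebraic_I)
  have hpi' : (Real.pi : ℂ) ∈ adjoin ℚ (G ∪ {I}) := by
    have hI : I ∈ adjoin ℚ (G ∪ {I}) := subset_adjoin ℚ _ (Or.inr (Set.mem_singleton I))
    have hpiI : (Real.pi : ℂ) * I ∈ adjoin ℚ (G ∪ {I}) :=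
      subset_adjoin ℚ _ (Or.inl (Or.inl (Or.inl ⟨0, rfl⟩)))
    have h : (Real.pi : ℂ) = ((Real.pi : ℂ) * I) * (-I) := by
      rw [mul_assoc, mul_neg, Complex.I_mul_I, neg_neg, mul_one]
    rw [h]
    exact mul_mem hpiI (neg_mem hI)
  have hepi' : cexp (Real.pi : ℂ) ∈ adjoin ℚ (G ∪ {I}) :=
    subset_adjoin ℚ _ (Or.inl (Or.inr (Or.inl ⟨0, rfl⟩)))
  let x : Fin 2 → ↥(adjoin ℚ (G ∪ {I})) := ![⟨(Real.pi : ℂ), hpi'⟩, ⟨cexp (Real.pi : ℂ), hepi'⟩]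
  have hx : AlgebraicIndependent ℚ x := by
    refine AlgebraicIndependent.of_comp (adjoin ℚ (G ∪ {I})).val ?_
    convert algebraicIndependent_pi_exp_pi hN using 1
    funext i
    fin_cases i <;> rfl
  have hF2 : (2 : Cardinal) ≤ Algebra.trdeg ℚ ↥(adjoin ℚ G) := by
    rw [← hFI]
    simpa using hx.cardinalMk_le_trdeg
  calc Algebra.trdeg ℚ ↥(adjoin ℚ (Set.range ![(Real.pi : ℂ) * I] ∪
          Set.range (cexp ∘ ![(Real.pi : ℂ) * I]))) + ((1 : ℕ) : Cardinal)
        ≤ 1 + 1 := add_le_add hbase (by simp)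
    _ = 2 := by norm_num
    _ ≤ Algebra.trdeg ℚ ↥(adjoin ℚ G) := hF2

end Summit.Schanuel.Schanuel.Theorems.RootDecomp1JSecondExpCells

end
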